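import Summits.Ventures.PercRepro.PuncturedLYMPavingIn
import Summits.Ventures.PercRepro.PuncturedLYMTwoCoHypTheorem

/-!
# PercRepro — TWO DISJOINT CO-HYPERPLANES, PART 9: (NC) FOR EVERY PAVING MATROID WITH TWO NONTRIVIAL HYPERPLANES
COVERING THE GROUND SET (p10, gen 35)

* `puncturedNMP_in_union_upLevel` — the two-co-hyperplane theorem of part 8 transported inside any finset `E`
  (the gen-31 subtype dictionary);
* `cocode_eq_union_upLevelIn` — if the dependent `r`-subsets of `gr M` are exactly the `r`-subsets of `H₁` or of `H₂`,
  the co-code is `upLevelIn (n − r) (gr M) (gr M ∖ H₁) ∪ upLevelIn (n − r) (gr M) (gr M ∖ H₂)`;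
* `IsTwoHyperplaneF M r H₁ H₂` — a paving matroid of rank `r` whose dependent `r`-sets are the `r`-subsets of two
  proper subsets `H₁, H₂` of size `≥ r` with `H₁ ∪ H₂ = gr M` and `#(H₁ ∩ H₂) ≤ r − 2` (the last condition holds for
  any two distinct hyperplanes of a paving matroid: their intersection is a flat of rank `≤ r − 2`, hence of size
  `≤ r − 2`; it is kept as a hypothesis here);
* **`normConsAt_of_twoHyperplane`** — **(NC) holds for every such matroid with `r + 1 ≤ n ≤ 2r − 2`**: the co-code is
  the union of two disjoint co-hyperplanes `gr M ∖ H₁`, `gr M ∖ H₂` of sizes in `[1, n − r]` with `#C₁ + #C₂ ≥ n − r + 2`,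
  the explicit two-co-hyperplane flow gives (SP) inside `gr M`, and the paving bridge of gen 34 finishes.
In the dictionary of S5 this is the second class of paving matroids (after "at most one nontrivial hyperplane",
gen 33–34) on which the bottom step of (NC) — conjecture (PAV) — is a theorem.  Nothing here asserts (SP), (PAV) or
(NC) in general.
-/

open scoped Matroid

namespace PercRepro.PuncturedLYM

open Finset

variable {α : Type} [DecidableEq α]

/-- **(SP) inside `E` for the `j`-subsets of `E` containing neither of two disjoint sets** `C₁, C₂ ⊆ E` with
`1 ≤ #C₁, #C₂ ≤ j`, `#C₁ + #C₂ ≥ j + 2` and `2j + 1 ≤ #E`. -/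
theorem puncturedNMP_in_union_upLevel {j : ℕ} {E C₁ C₂ : Finset α} (hC₁ : C₁ ⊆ E) (hC₂ : C₂ ⊆ E)
    (hdisj : Disjoint C₁ C₂) (hm₁ : 1 ≤ C₁.card) (hm₁j : C₁.card ≤ j) (hm₂ : 1 ≤ C₂.card) (hm₂j : C₂.card ≤ j)
    (hbig : j + 2 ≤ C₁.card + C₂.card) (hn : 2 * j + 1 ≤ E.card) :
    PuncturedNMPIn j E (upLevelIn j E C₁ ∪ upLevelIn j E C₂) := by
  apply puncturedNMP_in_of_subtype'
  · intro B hB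
    rcases mem_union.1 hB with h | h <;> exact subset_of_mem_upLevelIn h
  · rw [image_union, image_toSub_upLevelIn hC₁, image_toSub_upLevelIn hC₂]
    apply puncturedNMP_union_upLevel
    · rw [disjoint_iff_inter_eq_empty, ← toSub_inter, disjoint_iff_inter_eq_empty.1 hdisj]
      ext a
      rw [mem_toSub]
      simp
    · rw [card_toSub hC₁]
      exact hm₁
    · rw [card_toSub hC₁]
      exact hm₁j
    · rw [card_toSub hC₂]
      exact hm₂
    · rw [card_toSub hC₂]
      exact hm₂j
    · rw [card_toSub hC₁, card_toSub hC₂]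
      exact hbig
    · rw [Fintype.card_coe]
      exact hn

end PercRepro.PuncturedLYM

namespace PercRepro.Cogirth

open Finset ThmH Skew

variable {α : Type} [DecidableEq α] {M : Matroid α} [M.Finite]

/-- For `X ⊆ E`: `E ∖ X ⊆ H ↔ E ∖ H ⊆ X`. -/
theorem sdiff_subset_iff_sdiff_subset {E X H : Finset α} : E \ X ⊆ H ↔ E \ H ⊆ X := by
  constructor
  · intro h z hz
    rw [mem_sdiff] at hz
    by_contra hzX
    exact hz.2 (h (mem_sdiff.2 ⟨hz.1, hzX⟩))
  · intro h z hz
    rw [mem_sdiff] at hz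
    by_contra hzH
    exact hz.2 (h (mem_sdiff.2 ⟨hz.1, hzH⟩))

/-- If the dependent `r`-subsets of `gr M` are exactly the `r`-subsets of `H₁` or of `H₂` (`r ≤ n`), the co-code is
the union of the two families of `(n − r)`-subsets of `gr M` containing `gr M ∖ H₁`, resp. `gr M ∖ H₂`. -/
theorem cocode_eq_union_upLevelIn {r : ℕ} (hr : r ≤ (gr M).card) {H₁ H₂ : Finset α}
    (hH : ∀ S ⊆ gr M, S.card = r → (rk M S ≠ S.card ↔ S ⊆ H₁ ∨ S ⊆ H₂)) :
    cocode M r = PuncturedLYM.upLevelIn ((gr M).card - r) (gr M) (gr M \ H₁) ∪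
      PuncturedLYM.upLevelIn ((gr M).card - r) (gr M) (gr M \ H₂) := by
  ext X
  rw [mem_cocode, mem_union, PuncturedLYM.mem_upLevelIn, PuncturedLYM.mem_upLevelIn]
  constructor
  · rintro ⟨⟨hXg, hXc⟩, hdep⟩
    have hSc : (gr M \ X).card = r := by
      rw [card_sdiff_of_subset hXg, hXc]
      omega
    rcases (hH _ sdiff_subset hSc).1 hdep with h | h
    · exact Or.inl ⟨⟨hXg, hXc⟩, sdiff_subset_iff_sdiff_subset.1 h⟩
    · exact Or.inr ⟨⟨hXg, hXc⟩, sdiff_subset_iff_sdiff_subset.1 h⟩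
  · rintro (⟨⟨hXg, hXc⟩, hHX⟩ | ⟨⟨hXg, hXc⟩, hHX⟩)
    · refine ⟨⟨hXg, hXc⟩, ?_⟩
      have hSc : (gr M \ X).card = r := by
        rw [card_sdiff_of_subset hXg, hXc]
        omega
      exact (hH _ sdiff_subset hSc).2 (Or.inl (sdiff_subset_iff_sdiff_subset.2 hHX))
    · refine ⟨⟨hXg, hXc⟩, ?_⟩
      have hSc : (gr M \ X).card = r := by
        rw [card_sdiff_of_subset hXg, hXc]
        omega
      exact (hH _ sdiff_subset hSc).2 (Or.inr (sdiff_subset_iff_sdiff_subset.2 hHX))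

/-- **A paving matroid with two nontrivial hyperplanes covering the ground set**: rank `r`, every set with fewer than
`r` elements independent, the dependent `r`-subsets of the ground set are exactly the `r`-subsets of `H₁` or of `H₂`,
where `H₁, H₂` are proper subsets of the ground set of size `≥ r` with `H₁ ∪ H₂ = gr M` and `#(H₁ ∩ H₂) ≤ r − 2`. -/
def IsTwoHyperplaneF (M : Matroid α) [M.Finite] (r : ℕ) (H₁ H₂ : Finset α) : Prop :=
  rk M (gr M) = r ∧ IsPaving M ∧ H₁ ⊆ gr M ∧ H₂ ⊆ gr M ∧ H₁ ∪ H₂ = gr M ∧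
    H₁.card < (gr M).card ∧ H₂.card < (gr M).card ∧ r ≤ H₁.card ∧ r ≤ H₂.card ∧ (H₁ ∩ H₂).card + 2 ≤ r ∧
    ∀ S ⊆ gr M, S.card = r → (rk M S ≠ S.card ↔ S ⊆ H₁ ∨ S ⊆ H₂)

/-- **(NC) FOR EVERY PAVING MATROID WITH TWO NONTRIVIAL HYPERPLANES COVERING THE GROUND SET**, with
`r + 1 ≤ n ≤ 2r − 2`: the co-code is `upLevelIn (n − r) (gr M) C₁ ∪ upLevelIn (n − r) (gr M) C₂` for the disjoint
co-hyperplanes `C_i = gr M ∖ H_i` with `1 ≤ #C_i ≤ n − r`, `#C₁ + #C₂ ≥ n − r + 2` and `2(n − r) + 1 ≤ n`; the explicit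
two-co-hyperplane flow gives (SP) inside `gr M` and the paving bridge finishes. -/
theorem normConsAt_of_twoHyperplane {r : ℕ} {H₁ H₂ : Finset α} (h2 : IsTwoHyperplaneF M r H₁ H₂)
    (hr1 : r + 1 ≤ (gr M).card) (hn : (gr M).card + 2 ≤ 2 * r) : NormConsAt M := by
  obtain ⟨hrk, hp, hH₁g, hH₂g, hcover, hH₁n, hH₂n, hrH₁, hrH₂, hinter, hH⟩ := h2
  apply normConsAt_of_paving_of_puncturedNMPIn hp hrk hr1 hn
  rw [cocode_eq_union_upLevelIn (by omega) hH]
  have hcard := card_union_add_card_inter H₁ H₂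
  rw [hcover] at hcard
  apply PuncturedLYM.puncturedNMP_in_union_upLevel sdiff_subset sdiff_subset
  · rw [disjoint_left]
    intro z h1 h2
    rw [mem_sdiff] at h1 h2
    have : z ∈ H₁ ∪ H₂ := hcover ▸ h1.1
    rcases mem_union.1 this with h | h
    · exact h1.2 h
    · exact h2.2 h
  · rw [card_sdiff_of_subset hH₁g]
    omega
  · rw [card_sdiff_of_subset hH₁g]
    omega
  · rw [card_sdiff_of_subset hH₂g]
    omega
  · rw [card_sdiff_of_subset hH₂g]
    omega
  · rw [card_sdiff_of_subset hH₁g, card_sdiff_of_subset hH₂g]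
    omega
  · omega

end PercRepro.Cogirth
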